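import Literature.NumberTheory.Transcendental.RoySmallValueEstimatesNotInProofs
import Literature.NumberTheory.Transcendental.RoySmallValueEstimatesClosestGamPProofs
import Mathlib.Order.ConditionallyCompleteLattice.Basic
import HarnessLib

/-!
# Small value estimates at rational translates (Nguyen–Roy 2016) — proofs, XXVIII: the core of Corollary 16 (from a test-family inequality to `∑ (D^β + log dist)`)

Twenty-eighth proofs file towards `Literature.NumberTheory.Transcendental.nguyenRoy2016_thm_1` (Nguyen–Roy,
IJNT 12 (2016) = arXiv:1412.5163). Everything here is PROVED; no named facts. The proof of
**Corollary 16** (§5):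

> "Proposition 2.3 of [R2012] gives `∑_{α ∈ Z_D} log sup{|P(α)| ; P ∈ 𝒞_D} ≤ h_{𝒞_D}(Z_D) − …`.
> For each `P ∈ I_D^{(T)}` with `‖P‖ = 1`, we have `e^{2D^β}P ∈ 𝒞_D`. So … `2D^β + log|I_D^{(T)}|_α
> ≤ log sup{|P(α)| ; P ∈ 𝒞_D}`. Moreover … Proposition 10 gives
> `log dist(α, 𝒮) ≤ T^{3/2} log(c₃) + log |I_D^{(T)}|_α ≤ D^β/2 + log|I_D^{(T)}|_α`. Combining …"

in the elimination-free form the tree supports (seat-B files for [R2012]: the comparison with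
`h_𝒞` is replaced by an inequality valid for EVERY family of test forms `R_a ∈ 𝒞_D`, one per point
`a` of `Z_D`, cf. `Roy2013.step2_core`, `RoySmallValueConjugateFamilies`). For a finite set `A` of
algebraic points and a bound `∏_{a ∈ A} |R_a(nv a)| ≤ e^{−B}` for all test families in the body

  `𝒞 = {R ∈ ℂ[X]_D : ‖R‖ ≤ e^Y, |R(γ̲ᵢ)| ≤ e^{−U} (0 ≤ i < T)}`     (`InBody`),

we prove `∑_{a ∈ A} (Y + log dist(a, γ_{ι a})) ≤ −B + #A (log 2 + log c₁₀(L))` with closest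
indices `0 ≤ ι a < T` (`sum_log_pdist_le_of_tests`):

* `InIdeal` (`I_D^{(T)}`), `InBody` (`𝒞`), `idealVal D T a = |I_D^{(T)}|_a` (a supremum of
  normalised values `pval P D a / 𝓛(P)`), `pval_le_mul_idealVal`, `exists_near_idealVal`;
* `exists_pdist_le_idealVal` — Proposition 10 at a point: `dist(a, γᵢ) ≤ c₁₀(L) |I_D^{(T)}|_a`;
* `exists_test` — the test `R_a = e^Y P/𝓛(P) ∈ 𝒞` with `|R_a(v)| ≥ e^Y ‖v‖^D |I|_a / 2`;
* **`sum_log_pdist_le_of_tests`**.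

## References

* [NguyenRoy2016] N. A. V. Nguyen, D. Roy, IJNT 12 (2016) 1273–1293 = arXiv:1412.5163, §5,
  Corollary 16 and its proof; Proposition 10.
* [Roy2013] D. Roy, Mathematika 59 (2013), Prop. 2.3 (the role of `h_𝒞`).
-/

noncomputable section

open MvPolynomial Finset Height
open Literature.NumberTheory.Transcendental.Nesterenko
open Literature.NumberTheory.Transcendental.Roy2013 (CX)
open scoped Classical

namespace Literature.NumberTheory.Transcendental

namespace NguyenRoy

/-! ### Values of forms at points of norm at most one -/

/-- `|P(v)| ≤ 𝓛(P)` for `‖v‖ ≤ 1`. [folklore] -/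
theorem norm_eval_le_l1Norm_of_norm_le_one (P : CX) {v : V3} (hv : ‖v‖ ≤ 1) :
    ‖eval v P‖ ≤ l1Norm P := by
  rw [eval_eq, l1Norm]
  refine (norm_sum_le _ _).trans (Finset.sum_le_sum fun m _ => ?_)
  rw [norm_mul]
  refine mul_le_of_le_one_right (norm_nonneg _) ?_
  rw [norm_prod]
  refine Finset.prod_le_one (fun i _ => norm_nonneg _) fun i _ => ?_
  rw [norm_pow]
  exact pow_le_one₀ (norm_nonneg _) ((norm_le_pi_norm v i).trans hv)

/-- `pval P D a ≤ 𝓛(P)` for a form of degree `D`. [folklore] -/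
theorem pval_le_l1Norm {P : CX} {D : ℕ} (hP : P.IsHomogeneous D) (a : PPt) : pval P D a ≤ l1Norm P := by
  rw [← Projectivization.mk_rep a, pval_eq_norm_eval_unit hP a.rep_nonzero]
  exact norm_eval_le_l1Norm_of_norm_le_one P (norm_unit_smul a.rep_nonzero).le

section core

variable (ξ η r s : ℂ)

/-- `P ∈ I_D^{(T)}`: a form of degree `D` vanishing at `γ̲₀, …, γ̲_{T−1}`.
[cite: NguyenRoy2016, Definition 9] -/
def InIdeal (D T : ℕ) (P : CX) : Prop :=
  P.IsHomogeneous D ∧ ∀ i : ℕ, i < T → eval (gvec ξ η r s i) P = 0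

/-- `R ∈ 𝒞`: a form of degree `D` with `‖R‖ ≤ e^Y` and `|R(γ̲ᵢ)| ≤ e^{−U}` for `0 ≤ i < T` (the
convex body of §5, in the form of the tree's `royPhi_le_of_small_at_translates`).
[cite: NguyenRoy2016, §5 (𝒞_D)] -/
def InBody (D T : ℕ) (Y U : ℝ) (R : CX) : Prop :=
  R.IsHomogeneous D ∧ maxNorm R ≤ Real.exp Y ∧
    ∀ i : ℕ, i < T → ‖eval ![1, ξ + i * r, η * s ^ i] R‖ ≤ Real.exp (-U)

/-- The set of normalised values `pval P D a / 𝓛(P)`, `P ∈ I_D^{(T)} ∖ 0`, with `0` adjoined.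
[cite: NguyenRoy2016, §3 (`|I_D^{(T)}|_α`)] -/
def valSet (D T : ℕ) (a : PPt) : Set ℝ :=
  insert 0 ((fun P : CX => pval P D a / l1Norm P) '' {P | InIdeal ξ η r s D T P ∧ P ≠ 0})

/-- **`|I_D^{(T)}|_a`**: the supremum of `|P(a)|/(‖a‖^D 𝓛(P))` over `P ∈ I_D^{(T)} ∖ 0`.
[cite: NguyenRoy2016, §3 (`|I_D^{(T)}|_α`), proof of Corollary 16] -/
def idealVal (D T : ℕ) (a : PPt) : ℝ := sSup (valSet ξ η r s D T a)

variable {ξ η r s}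

/-- `𝓛(P) > 0` for `P ≠ 0`. [folklore] -/
theorem l1Norm_pos_of_ne_zero {P : CX} (hP : P ≠ 0) : 0 < l1Norm P :=
  (maxNorm_pos hP).trans_le (maxNorm_le_l1Norm P)

/-- The value set is bounded by `1`. [folklore] -/
theorem valSet_le_one {D T : ℕ} {a : PPt} {x : ℝ} (hx : x ∈ valSet ξ η r s D T a) : x ≤ 1 := by
  rcases hx with rfl | ⟨P, ⟨hI, hP0⟩, rfl⟩
  · exact zero_le_one
  · exact (div_le_one (l1Norm_pos_of_ne_zero hP0)).mpr (pval_le_l1Norm hI.1 a)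

/-- The value set is non-negative. [folklore] -/
theorem valSet_nonneg {D T : ℕ} {a : PPt} {x : ℝ} (hx : x ∈ valSet ξ η r s D T a) : 0 ≤ x := by
  rcases hx with rfl | ⟨P, ⟨_, hP0⟩, rfl⟩
  · exact le_rfl
  · exact div_nonneg (pval_nonneg _ _ _) (l1Norm_nonneg _)

/-- Boundedness. [folklore] -/
theorem bddAbove_valSet (D T : ℕ) (a : PPt) : BddAbove (valSet ξ η r s D T a) :=
  ⟨1, fun _ hx => valSet_le_one hx⟩

/-- `0 ≤ |I|_a ≤ 1`. [folklore] -/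
theorem idealVal_nonneg (D T : ℕ) (a : PPt) : 0 ≤ idealVal ξ η r s D T a :=
  le_csSup (bddAbove_valSet D T a) (Set.mem_insert _ _)

/-- `|I|_a ≤ 1`. [folklore] -/
theorem idealVal_le_one (D T : ℕ) (a : PPt) : idealVal ξ η r s D T a ≤ 1 :=
  csSup_le ⟨0, Set.mem_insert _ _⟩ fun _ hx => valSet_le_one hx

/-- **`pval P D a ≤ 𝓛(P) |I|_a`** for `P ∈ I_D^{(T)}`. [cite: NguyenRoy2016, §3] -/
theorem pval_le_mul_idealVal {D T : ℕ} {P : CX} (hP : InIdeal ξ η r s D T P) (a : PPt) :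
    pval P D a ≤ l1Norm P * idealVal ξ η r s D T a := by
  by_cases hP0 : P = 0
  · subst hP0
    have h0 : pval (0 : CX) D a = 0 := by simp [pval]
    rw [h0]
    exact mul_nonneg (l1Norm_nonneg _) (idealVal_nonneg D T a)
  · have hL := l1Norm_pos_of_ne_zero hP0
    have h : pval P D a / l1Norm P ≤ idealVal ξ η r s D T a :=
      le_csSup (bddAbove_valSet D T a) (Set.mem_insert_of_mem _ ⟨P, ⟨hP, hP0⟩, rfl⟩)
    rwa [div_le_iff₀' hL] at h

/-- Approximating the supremum: if `|I|_a > 0` there is `P ∈ I_D^{(T)} ∖ 0` with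
`pval P D a / 𝓛(P) > |I|_a / 2`. [folklore] -/
theorem exists_near_idealVal {D T : ℕ} {a : PPt} (h : 0 < idealVal ξ η r s D T a) :
    ∃ P : CX, InIdeal ξ η r s D T P ∧ P ≠ 0 ∧
      idealVal ξ η r s D T a / 2 < pval P D a / l1Norm P := by
  have hlt : idealVal ξ η r s D T a / 2 < idealVal ξ η r s D T a := by linarith
  obtain ⟨x, hx, hltx⟩ := exists_lt_of_lt_csSup ⟨0, Set.mem_insert _ _⟩ hlt
  rcases hx with rfl | ⟨P, ⟨hI, hP0⟩, rfl⟩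
  · linarith
  · exact ⟨P, hI, hP0, hltx⟩

/-- **Proposition 10 at a point**: `dist(a, γᵢ) ≤ c₁₀(L) |I_D^{(T)}|_a` for some `0 ≤ i < T`
(`1 ≤ T ≤ binom(L+2,2)`, `L < D`, `|s| > 1`). [cite: NguyenRoy2016, Prop. 10; proof of Cor. 16] -/
theorem exists_pdist_le_idealVal (hr : r ≠ 0) (hη : η ≠ 0) (hs : 1 < ‖s‖) {D T L : ℕ} (hT : 1 ≤ T)
    (hTM : T ≤ (L + 1) * (L + 2) / 2) (hLD : L < D) (a : PPt) :
    ∃ i : ℕ, i < T ∧ pdist a (gamP ξ η r s i) ≤ c10 ξ η r s L * idealVal ξ η r s D T a := by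
  have ha := a.rep_nonzero
  obtain ⟨i, hi, h⟩ := exists_pdist_gamP_le hr hη hs hT hTM hLD ha (idealVal_nonneg D T a)
    (fun P hP hvan => by
      have h1 := pval_le_mul_idealVal (ξ := ξ) (η := η) (r := r) (s := s) ⟨hP, hvan⟩ a
      change ‖eval a.rep P‖ / ‖a.rep‖ ^ D ≤ _ at h1
      rw [div_le_iff₀ (pow_pos (norm_pos_iff.mpr ha) D)] at h1
      linarith [h1])
  rw [Projectivization.mk_rep] at h
  exact ⟨i, hi, h⟩

/-- **The test form of a point**: if `|I|_a > 0` there is `R ∈ 𝒞` (`R = e^Y P/𝓛(P)`, `P ∈ I_D^{(T)}`)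
with `|R(v)| ≥ e^Y ‖v‖^D |I|_a / 2` at every representative `v` of `a`.
[cite: NguyenRoy2016, proof of Corollary 16 ("e^{2D^β}P ∈ 𝒞_D")] -/
theorem exists_test {D T : ℕ} {Y U : ℝ} {a : PPt} (h : 0 < idealVal ξ η r s D T a) :
    ∃ R : CX, InBody ξ η r s D T Y U R ∧ ∀ (v : V3) (hv : v ≠ 0), Projectivization.mk ℂ v hv = a →
      Real.exp Y * ‖v‖ ^ D * (idealVal ξ η r s D T a / 2) ≤ ‖eval v R‖ := by
  obtain ⟨P, hI, hP0, hlt⟩ := exists_near_idealVal h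
  have hL := l1Norm_pos_of_ne_zero hP0
  set c : ℂ := ((Real.exp Y / l1Norm P : ℝ) : ℂ) with hc
  have hcn : ‖c‖ = Real.exp Y / l1Norm P := by
    rw [hc, Complex.norm_real, Real.norm_eq_abs, abs_of_pos (div_pos (Real.exp_pos Y) hL)]
  refine ⟨C c * P, ⟨hI.1.C_mul c, ?_, fun i hi => ?_⟩, fun v hv hva => ?_⟩
  · calc maxNorm (C c * P) ≤ l1Norm (C c * P) := maxNorm_le_l1Norm _
      _ ≤ l1Norm (C c : CX) * l1Norm P := l1Norm_mul_le _ _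
      _ = Real.exp Y := by rw [l1Norm_C, hcn, div_mul_cancel₀ _ hL.ne']
  · rw [map_mul, eval_C, ← gvec_natCast, hI.2 i hi, mul_zero, norm_zero]
    exact (Real.exp_pos _).le
  · rw [map_mul, eval_C, norm_mul, hcn]
    have h1 : idealVal ξ η r s D T a / 2 < ‖eval v P‖ / ‖v‖ ^ D / l1Norm P := by
      rw [← pval_mk hI.1 hv, hva]; exact hlt
    have hvD : 0 < ‖v‖ ^ D := pow_pos (norm_pos_iff.mpr hv) D
    rw [lt_div_iff₀ hL, lt_div_iff₀ hvD] at h1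
    calc Real.exp Y * ‖v‖ ^ D * (idealVal ξ η r s D T a / 2)
        = Real.exp Y / l1Norm P * (idealVal ξ η r s D T a / 2 * l1Norm P * ‖v‖ ^ D) := by
          field_simp
      _ ≤ Real.exp Y / l1Norm P * ‖eval v P‖ :=
          mul_le_mul_of_nonneg_left h1.le (div_pos (Real.exp_pos Y) hL).le

/-- **From the test-family inequality to `∑ (Y + log dist)`** (the proof of Corollary 16). Let `A`
be a finite set of points of `ℙ²(ℂ)` at positive distance from `γ₀, …, γ_{T−1}`, and suppose that
`∏_{a ∈ A} |R_a(nv a)| ≤ e^{−B}` for every family of tests `R_a ∈ 𝒞`. Then, with closest indices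
`0 ≤ ι a < T`, `∑_{a ∈ A} (Y + log dist(a, γ_{ι a})) ≤ −B + #A (log 2 + log c₁₀(L))`.
[cite: NguyenRoy2016, Corollary 16 and its proof] -/
theorem sum_log_pdist_le_of_tests (hr : r ≠ 0) (hη : η ≠ 0) (hs : 1 < ‖s‖) {D T L : ℕ}
    (hT : 1 ≤ T) (hTM : T ≤ (L + 1) * (L + 2) / 2) (hLD : L < D) {Y U B : ℝ} (A : Finset PPt)
    (hpos : ∀ a ∈ A, ∀ i : ℕ, i < T → 0 < pdist a (gamP ξ η r s i))
    (hsmall : ∀ R : PPt → CX, (∀ a ∈ A, InBody ξ η r s D T Y U (R a)) →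
      ∏ a ∈ A, ‖eval (nv a) (R a)‖ ≤ Real.exp (-B)) :
    ∃ ι : PPt → ℕ, (∀ a ∈ A, ι a < T) ∧
      ∑ a ∈ A, (Y + Real.log (pdist a (gamP ξ η r s (ι a)))) ≤
        -B + A.card * (Real.log 2 + Real.log (c10 ξ η r s L)) := by
  -- the closest indices (Proposition 10) and positivity of `|I|_a`
  have hP10 : ∀ a : PPt, ∃ i : ℕ, i < T ∧
      pdist a (gamP ξ η r s i) ≤ c10 ξ η r s L * idealVal ξ η r s D T a := fun a =>
    exists_pdist_le_idealVal hr hη hs hT hTM hLD a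
  choose ι hιT hιd using hP10
  have hc10 : ∀ a ∈ A, 0 < c10 ξ η r s L := by
    intro a ha
    have h1 := hιd a
    have h2 := hpos a ha (ι a) (hιT a)
    by_contra hle
    push Not at hle
    have : c10 ξ η r s L * idealVal ξ η r s D T a ≤ 0 :=
      mul_nonpos_of_nonpos_of_nonneg hle (idealVal_nonneg D T a)
    linarith
  have hIpos : ∀ a ∈ A, 0 < idealVal ξ η r s D T a := by
    intro a ha
    have h1 := hιd a
    have h2 := hpos a ha (ι a) (hιT a)
    by_contra hle
    push Not at hle
    have h0 : idealVal ξ η r s D T a = 0 := le_antisymm hle (idealVal_nonneg D T a)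
    rw [h0, mul_zero] at h1
    linarith
  -- the tests
  have htest : ∀ a : PPt, ∃ R : CX, a ∈ A → InBody ξ η r s D T Y U R ∧
      Real.exp Y * ‖nv a‖ ^ D * (idealVal ξ η r s D T a / 2) ≤ ‖eval (nv a) R‖ := by
    intro a
    by_cases ha : a ∈ A
    · obtain ⟨R, hR, hRv⟩ := exists_test (Y := Y) (U := U) (hIpos a ha)
      exact ⟨R, fun _ => ⟨hR, hRv (nv a) (nv_ne_zero a) (mk_nv a)⟩⟩
    · exact ⟨0, fun h => absurd h ha⟩
  choose R hR using htest
  have hprod := hsmall R fun a ha => (hR a ha).1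
  -- lower bound for the product
  have hlow : ∀ a ∈ A, Real.exp Y * (idealVal ξ η r s D T a / 2) ≤ ‖eval (nv a) (R a)‖ := by
    intro a ha
    refine le_trans ?_ (hR a ha).2
    have h1 : (1 : ℝ) ≤ ‖nv a‖ ^ D := one_le_pow₀ (by
      have := norm_le_pi_norm (nv a) (piv a)
      rw [nv_piv, norm_one] at this
      exact this)
    have h2 : 0 ≤ Real.exp Y * (idealVal ξ η r s D T a / 2) :=
      mul_nonneg (Real.exp_pos Y).le (by linarith [hIpos a ha])
    nlinarith
  have hlowpos : ∀ a ∈ A, 0 < Real.exp Y * (idealVal ξ η r s D T a / 2) := fun a ha =>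
    mul_pos (Real.exp_pos Y) (by linarith [hIpos a ha])
  have hprod2 : ∏ a ∈ A, (Real.exp Y * (idealVal ξ η r s D T a / 2)) ≤ Real.exp (-B) :=
    (Finset.prod_le_prod (fun a ha => (hlowpos a ha).le) hlow).trans hprod
  have hlog := Real.log_le_log (Finset.prod_pos hlowpos) hprod2
  rw [Real.log_exp, Real.log_prod (s := A) (fun a ha => (hlowpos a ha).ne')] at hlog
  -- per-point logarithms
  refine ⟨ι, fun a _ => hιT a, ?_⟩
  have hpt : ∀ a ∈ A, Y + Real.log (pdist a (gamP ξ η r s (ι a))) ≤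
      Real.log (Real.exp Y * (idealVal ξ η r s D T a / 2)) +
        (Real.log 2 + Real.log (c10 ξ η r s L)) := by
    intro a ha
    have hI := hIpos a ha
    rw [Real.log_mul (Real.exp_pos Y).ne' (by linarith), Real.log_exp,
      Real.log_div hI.ne' two_ne_zero]
    have h1 : Real.log (pdist a (gamP ξ η r s (ι a))) ≤
        Real.log (c10 ξ η r s L * idealVal ξ η r s D T a) :=
      Real.log_le_log (hpos a ha _ (hιT a)) (hιd a)
    rw [Real.log_mul (hc10 a ha).ne' hI.ne'] at h1
    linarith
  calc ∑ a ∈ A, (Y + Real.log (pdist a (gamP ξ η r s (ι a))))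
      ≤ ∑ a ∈ A, (Real.log (Real.exp Y * (idealVal ξ η r s D T a / 2)) +
          (Real.log 2 + Real.log (c10 ξ η r s L))) := Finset.sum_le_sum hpt
    _ = ∑ a ∈ A, Real.log (Real.exp Y * (idealVal ξ η r s D T a / 2)) +
          A.card * (Real.log 2 + Real.log (c10 ξ η r s L)) := by
        rw [Finset.sum_add_distrib, Finset.sum_const, nsmul_eq_mul]
    _ ≤ -B + A.card * (Real.log 2 + Real.log (c10 ξ η r s L)) := by linarith

/-! ### `Z ⊆ W_D` from the test-family inequality -/

/-- **A non-vanishing `Φʲ P̃_D` on a `Z ⊄ W_D` and Liouville's inequality** (the first half of the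
proof of `notIn`): some `Φʲ P̃_D`, `0 ≤ j < 2⌊D^σ⌋`, has `pval > 0` on the conjugates of `Z` and
`∑_{a ∈ Z} log pval(Φʲ P̃_D)(a) ≥ −D h(Z)`. [cite: NguyenRoy2016, §5; Roy2013, Prop. 2.4] -/
theorem exists_fpoly_pos_of_not_isIn {r s : ℚ} {σ₀ β ν : ℝ} {Pt : ℕ → MvPolynomial (Fin 3) ℤ}
    {D : ℕ} (hD : PropsAt ξ η r s σ₀ β ν Pt D) (Zv : AlgPt) (hnot : ¬ IsIn r s σ₀ Pt Zv D) :
    ∃ j : ℕ, j < 2 * ⌊(D : ℝ) ^ σ₀⌋₊ ∧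
      (∀ a ∈ Zv.conj, 0 < pval (Fpoly r s Pt D j) D a) ∧
      -((D : ℝ) * Zv.ht) ≤ ∑ a ∈ Zv.conj, Real.log (pval (Fpoly r s Pt D j) D a) := by
  obtain ⟨j, hj, Q, hQmap, haQ⟩ : ∃ j : ℕ, j < 2 * ⌊(D : ℝ) ^ σ₀⌋₊ ∧ ∃ Q : MvPolynomial (Fin 3) ℤ,
      map (Int.castRingHom ℂ) Q = Fpoly r s Pt D j ∧ aeval (ap Zv.1) Q ≠ 0 := by
    by_contra hcon
    push Not at hcon
    exact hnot hcon
  obtain ⟨⟨Q', hQhom', hQmap', -⟩, -⟩ := hD.2.2 j (by omega)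
  obtain rfl : Q = Q' := int_model_unique (hQmap.trans hQmap'.symm)
  have hQhom : Q.IsHomogeneous D := hQhom'
  have hFhom : (map (Int.castRingHom ℂ) Q).IsHomogeneous D := hQhom.map _
  have hpv : ∀ q : PPt, pval (map (Int.castRingHom ℂ) Q) D q =
      ‖eval (nv q) (map (Int.castRingHom ℂ) Q)‖ / ‖nv q‖ ^ D := fun q => by
    conv_lhs => rw [← mk_nv q]
    exact pval_mk hFhom (nv_ne_zero q)
  refine ⟨j, hj, ?_, ?_⟩
  · intro a ha
    obtain ⟨φ, -, rfl⟩ := Finset.mem_image.mp ha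
    rw [← hQmap, hpv, Zv.eval_map_nv_embPt]
    exact div_pos (norm_pos_iff.mpr ((map_ne_zero φ.toRingHom).mpr haQ))
      (pow_pos (norm_pos_iff.mpr (nv_ne_zero _)) _)
  · have ha0 : ap Zv.1 ≠ 0 := fun h => by
      have := congrFun h (piv Zv.1)
      rw [ap_piv] at this
      exact one_ne_zero this
    have hL := Roy2013.neg_logHeight_le_sum_log (K := Kp Zv.1) hQhom ha0 haQ
    have hht : (D : ℝ) * logHeight (ap Zv.1) = D * Zv.ht := by
      rw [AlgPt.ht, Zv.habs_eq_logHeight_ap]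
      have hd : (0 : ℝ) < Zv.deg := by exact_mod_cast Zv.one_le_deg
      field_simp
    have key : -((D : ℝ) * logHeight (ap Zv.1)) ≤
        ∑ a ∈ Zv.conj, Real.log (pval (map (Int.castRingHom ℂ) Q) D a) := by
      refine hL.trans_eq ?_
      rw [AlgPt.conj, Finset.sum_image fun φ _ ψ _ h => Zv.embPt_injective h]
      refine Fintype.sum_equiv (RingHom.equivRatAlgHom) _ _ fun τ => ?_
      rw [hpv, Zv.eval_map_nv_embPt, Zv.nv_embPt]
      rfl
    rw [hht, hQmap] at key
    exact key

/-- **The translates `Φʲ P̃_D`, `j < 2⌊D^σ⌋`, belong to `𝒞_D`** (`Y = 2D^β`, `U = D^ν/2`,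
`T = ⌊D^σ⌋`). [cite: NguyenRoy2016, Prop. 4 and §5 ("P, Φ(P), …, all belong to 𝒞_D")] -/
theorem inBody_fpoly {r s : ℚ} (hs : s ≠ 0) {σ₀ β ν : ℝ} {Pt : ℕ → MvPolynomial (Fin 3) ℤ}
    {D : ℕ} (hD : PropsAt ξ η r s σ₀ β ν Pt D) {j : ℕ} (hj : j < 2 * ⌊(D : ℝ) ^ σ₀⌋₊) :
    InBody ξ η (r : ℂ) (s : ℂ) D ⌊(D : ℝ) ^ σ₀⌋₊ (2 * (D : ℝ) ^ β) ((D : ℝ) ^ ν / 2)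
      (Fpoly r s Pt D j) := by
  obtain ⟨⟨Q, hQhom, hQmap, hQht⟩, -⟩ := hD.2.2 j (by omega)
  refine ⟨?_, ?_, fun i hi => ?_⟩
  · rw [← hQmap]; exact hQhom.map _
  · rw [← hQmap]
    exact (maxNorm_map_le_mvPolyHeight Q).trans hQht
  · rw [← gvec_natCast, eval_gvec_Fpoly hs]
    have h := norm_eval_gvec_le hD (n := j + i) (by omega)
    have e : ((j : ℤ) + (i : ℕ)) = ((j + i : ℕ) : ℤ) := by push_cast; ring
    rw [e]
    rwa [show -(D : ℝ) ^ ν / 2 = -((D : ℝ) ^ ν / 2) by ring] at h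

/-- **`Z ⊆ W_D` from the test-family inequality.** If every family of tests `R_a ∈ 𝒞_D` on the
conjugates of `Z` has `∏_a |R_a(nv a)| ≤ e^{−B}` with `B > D h(Z)`, then `Z ⊆ W_D`: otherwise a
non-vanishing `Φʲ P̃_D ∈ 𝒞_D` used as a constant test family contradicts Liouville's inequality.
[cite: NguyenRoy2016, Prop. 15 ("contained in W_D"); Roy2013, Prop. 6.2 (`Z ⊆ 𝒵(𝒟ⁱP)`)] -/
theorem isIn_of_small {r s : ℚ} (hs : s ≠ 0) {σ₀ β ν : ℝ} {Pt : ℕ → MvPolynomial (Fin 3) ℤ}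
    {D : ℕ} (hD : PropsAt ξ η r s σ₀ β ν Pt D) (Zv : AlgPt) {B : ℝ} (hB : (D : ℝ) * Zv.ht < B)
    (small : ∀ R : PPt → CX,
      (∀ a ∈ Zv.conj, InBody ξ η (r : ℂ) (s : ℂ) D ⌊(D : ℝ) ^ σ₀⌋₊ (2 * (D : ℝ) ^ β)
        ((D : ℝ) ^ ν / 2) (R a)) →
      ∏ a ∈ Zv.conj, ‖eval (nv a) (R a)‖ ≤ Real.exp (-B)) :
    IsIn r s σ₀ Pt Zv D := by
  by_contra hnot
  obtain ⟨j, hj, hpos, hliou⟩ := exists_fpoly_pos_of_not_isIn hD Zv hnot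
  set F : CX := Fpoly r s Pt D j with hF
  have hFhom : F.IsHomogeneous D := (inBody_fpoly (ξ := ξ) (η := η) hs hD hj).1
  have hprod := small (fun _ => F) fun a _ => inBody_fpoly hs hD hj
  -- `pval F a ≤ |F(nv a)|`
  have hle : ∀ a ∈ Zv.conj, pval F D a ≤ ‖eval (nv a) F‖ := by
    intro a _
    rw [show pval F D a = pval F D (Projectivization.mk ℂ (nv a) (nv_ne_zero a)) by rw [mk_nv],
      pval_mk hFhom (nv_ne_zero a)]
    refine div_le_self (norm_nonneg _) (one_le_pow₀ ?_)
    have := norm_le_pi_norm (nv a) (piv a)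
    rw [nv_piv, norm_one] at this
    exact this
  have hpos' : ∀ a ∈ Zv.conj, 0 < ‖eval (nv a) F‖ := fun a ha => (hpos a ha).trans_le (hle a ha)
  have hlog := Real.log_le_log (Finset.prod_pos hpos') hprod
  rw [Real.log_exp, Real.log_prod (s := Zv.conj) (fun a ha => (hpos' a ha).ne')] at hlog
  have hsum : ∑ a ∈ Zv.conj, Real.log (pval F D a) ≤ ∑ a ∈ Zv.conj, Real.log ‖eval (nv a) F‖ :=
    Finset.sum_le_sum fun a ha => Real.log_le_log (hpos a ha) (hle a ha)
  linarith

end core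

end NguyenRoy

end Literature.NumberTheory.Transcendental

end
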